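import Literature.MathematicalPhysics.QuantumFieldTheory.Balaban1983to89.B8Ineq125Concrete

/-!
# `Balaban1983to89.B8Eq1122Concrete` — T. Bałaban, *Spaces of regular gauge field configurations on a lattice and gauge
# fixing conditions*, Commun. Math. Phys. **99** (1985) 75–102 [Balaban1985RegularSpaces], Sect. E pp. 96–97: the segment formula
# (1.122) and the displayed Lipschitz bound «`|C′(λ − H′X₁) − C′(λ − H′X₂)| ≦ C′₂ 2B′₀(α₃ + α₄)|X₁ − X₂|`» FOR THE CONCRETE REMAINDER
# `C′ = C′_j(u₁, ·)` of (213) [3] on the `ℤᵈ` carriers of the lineage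

statement-level skeleton of published theorems with citation tags; proofs where landed; nothing here is a claim about the Yang–Mills mass gap

PDF held: `paper:balaban1985-cmp99-regular-spaces-gauge-fixing` (journal page = PDF page + 74); pp. 96–97 read AS IMAGES on the
renders `run/shared/lean/pub/pub-balaban/b2b-balaban-ref1/pages/1985-cmp99-regular-spaces-gauge-fixing/…-p022-x2.png`, `…-p023-x2.png`
(this unit, 2026-08-21); [3] = T. Bałaban, *Averaging operations for lattice gauge theories*, Commun. Math. Phys. **98** (1985) 17–51
[Balaban1985Averaging], (207)–(208), (213)–(214) p. 50.

CITATION HEADER (lean-in-tree rule).  Cell `lit-balaban` (HOME `run/shared/lean/pub/lit-balaban/`), unit `lit-balaban-p05` (Phase-2 proof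
seat p05, gen 5; TAKING line HOME/STATUS.md 2026-08-21T06:31Z; free-target protocol G.5-34(d); owner of block B8 = `lit-balaban-r05`,
referee ref-4).  WHAT IS REPRODUCED = SKELETON row **`B8.Eq1.125`** ((1.122)–(1.125) pp. 96–97), member (1.122) and the display after
(1.125), for the lattice remainder `C′_j(u₁, λ) := Q′_j(u₁, λ) − Q′_jλ` = `B8Eq1123Concrete.Cnl` — file 3 of the series `B8Eq1123Concrete`
((1.123), analyticity), `B8Ineq125Concrete` ((1.124), (1.125)).

PRINT (pp. 96–97 [PDF 22–23], verbatim).  «We will prove that the mapping (1.118) is a contraction on the set (1.119) for `α₃, α₄`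
sufficiently small. We have `C′(λ − H′X₁) − C′(λ − H′X₂) = ∫₀¹ dt (d/dt) C′(λ − H′(tX₁ + (1−t)X₂)) = −∫₀¹ dt ⟨(δ/δλ)C′(λ − H′(tX₁ +
(1−t)X₂)), H′(X₁ − X₂)⟩`, (1.122) where the functional derivative `(δ/δλ)C′(λ)` is defined as the linear mapping `⟨(δ/δλ)C′(λ), λ₀⟩ =
(d/dτ) C′(λ + τλ₀)|_{τ=0}`. (1.123) … Applying it [(1.125)] to the expression (1.122) we have `|C′(λ − H′X₁) − C′(λ − H′X₂)| ≦
C′₂ 2B′₀(α₃ + α₄)|X₁ − X₂|`, hence the mapping (1.118) is contractive if e.g. `α₃ + α₄ ≦ 1/(4B′₀C′₂)`.»  Inputs (p. 96): (1.119)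
`|λ| < ½α₄, |Dλ| < ½α₄(Lʲη)⁻¹ on Ω_j, |X| < α₄/(2B′₀)`; (1.120) `|λ − H′X| < α₄, |D(λ − H′X)| < α₄(Lʲη)⁻¹ on Ω_j`.

WHAT THIS FILE PROVES (kernel, no `sorry`, standard axioms; carriers and data of `B8Eq1123Concrete`/`B8Ineq125Concrete`).
* §6 `segment_mem_dom207` — the sets (1.119)/(1.120) are convex (the segment `μ₂ + t(μ₁ − μ₂)`, `t ∈ [0, 1]`, stays inside);
  **(1.122)** `eq1122` — for `μ₁, μ₂` in the (207)-domain = (1.120): `C′(μ₁)(z) − C′(μ₂)(z) = ∫₀¹ ⟨δC′(μ₂ + t(μ₁ − μ₂)), μ₁ − μ₂⟩(z) dt`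
  (the fundamental theorem of calculus for the real restriction of the analytic curve `τ ↦ C′(μ₂ + τ(μ₁ − μ₂))(z)`; the integrand is its
  derivative by (1.123) translated along the segment, and is continuous); `eq1122_printed` — the displayed form WITH THE SIGN,
  `C′(λ − H′X₁) − C′(λ − H′X₂) = −∫₀¹⟨δC′(λ − H′(tX₁ + (1−t)X₂)), H′(X₁ − X₂)⟩ dt`, for ANY `ℂ`-linear `H′` (print: the operator of (1.92);
  its lattice construction is not needed for the identity); **`lipschitz1122`** — «Applying it to the expression (1.122)»: for `μ₁, μ₂` in
  (1.119) with `max{|μ₁ − μ₂|, |D(μ₁ − μ₂)|} ≤ m`, `‖C′(μ₁)(z) − C′(μ₂)(z)‖ ≤ C′₂·2m·(α₃ + α₄)·LʲL⁻ᵏ` — print's instance is `μᵢ = λ − H′Xᵢ`,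
  `m = B′₀|X₁ − X₂|` by (1.120)/(1.92) (READING (f)).
READINGS (recorded; none is an objection to print).  (a)–(d) of `B8Ineq125Concrete` (norm of `𝔸`; ONE-LEVEL (207)-domain, on which
print's unweighted modulus is exact; explicit smallness of (214); `max ≤ m`).  (e) The `H′`-bound `max{|H′X|, |DH′X|} ≤ B′₀|X|` ((1.120) from
(1.119), (1.92)) belongs to row B8.Eq1.91 (the lattice `H′`) and is NOT typed here: `lipschitz1122` is stated with the modulus `m` of
`μ₁ − μ₂` as datum, which is exactly what print's sentence consumes.  (f) DOMAIN OF (1.125) INSIDE (1.122) (HOME/GAPS.md G-B8-17, a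
located reading, constants only): the Cauchy circle of (1.124) with `|τλ₀| ≤ ½α₄` stays in the set (1.120), where (1.121) bounds `C′`, exactly
when its CENTRE lies in the half-size set (1.119); so (1.125) — and `lipschitz1122` — are stated for centres / end-points in (1.119), whereas
print applies (1.125) at the centres `λ − H′(tX₁ + (1−t)X₂)`, which its own (1.120) places only in the full-size set.  Since (214) of [3] holds
«for `α₄` sufficiently small» on the doubled set as well, print's sentence is the instance `α₄ ↦ 2α₄` of `lipschitz1122` (smallness of (214) at
`2α₄`; constant `C′₂·2m·(α₃ + 2α₄)`), an `O(1)` change inside the unstated `C′₂`.  NOT CLAIMED: the region-dependent form on `{Ω_j}`; the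
contraction /
fixed-point conclusion (rows B8.Eq1.113, B8.Claim@97: `B8SectEStatements`, `B8Claim97OntoProof` at the abstract Banach level).
DECLARATIONS: theorems only (2 private [folklore] helpers); no definition, no `… : Prop` fact.  REUSED BY NAME: `B8Eq1123Concrete.Cnl,
dCnl, cjDiff_line, analyticAt_Cnl_family, dCnl_neg`, `B8Ineq125Concrete.C2p, ineq1125`, `B7Eq170Flat.cj, cj_add, cj_neg`,
`B7Prop10Flat.one_le_C5`, Mathlib `intervalIntegral.integral_eq_sub_of_hasDerivAt`, `intervalIntegral.norm_integral_le_of_norm_le_const`,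
`AnalyticAt.deriv`, `deriv_comp_const_add`, `Complex.ofRealCLM`.
Unit `lit-balaban-p05` (gen 5), 2026-08-21.

[cite: Balaban1985RegularSpaces, (1.122) p.96, (1.122)–(1.125) pp.96–97, (1.119)–(1.120) p.96; Balaban1985Averaging, (207) p.50, (213) p.50]
-/

noncomputable section

open NormedSpace Finset Metric Set

namespace Literature.MathematicalPhysics.QuantumFieldTheory.Balaban1983to89.B8Eq1122Concrete

open B7Prop1Explicit B7Prop2Explicit MatrixLog B7Eq167Flat B7Prop9Flat B7Prop10General
open B7Prop10Flat (one_le_C5)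
open B7Eq170Flat (cj cj_apply cj_add cj_neg)
open B8Eq1123Concrete (Cnl dCnl analyticAt_Cnl_family cjDiff_line dCnl_neg)
open B8Ineq125Concrete (C2p ineq1125)

-- `Site` alone would resolve to the torus sites of `Setup.lean`; re-export the `ℤ^d` sites of `B7Prop1Explicit`.
export B7Prop1Explicit (Site)

variable {d : ℕ}

/-! ## §6 (1.122): the fundamental theorem of calculus along the segment, and the displayed Lipschitz bound -/

section Segment

variable {𝔸 : Type*} [NormedRing 𝔸] [NormedAlgebra ℂ 𝔸]

/-- Convexity of a norm ball along a real segment: `‖A₂ + t(A₁ − A₂)‖ < c` for `0 ≤ t ≤ 1` when `‖A₁‖, ‖A₂‖ < c` (the sets (1.119),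
(1.120) are convex). [folklore] -/
private theorem norm_add_real_smul_sub_lt {A₁ A₂ : 𝔸} {c t : ℝ} (h1 : ‖A₁‖ < c) (h2 : ‖A₂‖ < c) (ht0 : 0 ≤ t) (ht1 : t ≤ 1) :
    ‖A₂ + (t : ℂ) • (A₁ - A₂)‖ < c := by
  have hre : A₂ + (t : ℂ) • (A₁ - A₂) = (1 - t) • A₂ + t • A₁ := by
    rw [Complex.coe_smul, smul_sub, sub_smul, one_smul]; abel
  rw [hre]
  calc ‖(1 - t) • A₂ + t • A₁‖ ≤ ‖(1 - t) • A₂‖ + ‖t • A₁‖ := norm_add_le _ _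
    _ = (1 - t) * ‖A₂‖ + t * ‖A₁‖ := by
        rw [norm_smul, norm_smul, Real.norm_of_nonneg (by linarith), Real.norm_of_nonneg ht0]
    _ ≤ (1 - t) * max ‖A₁‖ ‖A₂‖ + t * max ‖A₁‖ ‖A₂‖ :=
        add_le_add (mul_le_mul_of_nonneg_left (le_max_right _ _) (by linarith))
          (mul_le_mul_of_nonneg_left (le_max_left _ _) ht0)
    _ = max ‖A₁‖ ‖A₂‖ := by ring
    _ < c := max_lt h1 h2

omit [NormedAlgebra ℂ 𝔸] in
/-- The covariant difference of `μ₁ − μ₂` is the difference of the covariant differences (`R(w)` is additive).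
[cite: Balaban1985RegularSpaces, (1.120) p.96; Balaban1985Averaging, (207) p.50] (elementary API; our proof) -/
theorem cjDiff_sub (w : 𝔸ˣ) (μ₁ μ₂ : Site d → 𝔸) (x y : Site d) :
    cj w ((μ₁ - μ₂) y) - (μ₁ - μ₂) x = (cj w (μ₁ y) - μ₁ x) - (cj w (μ₂ y) - μ₂ x) := by
  simp only [Pi.sub_apply, sub_eq_add_neg, cj_add, cj_neg]
  abel

/-- **The sets (1.119)/(1.120) are convex** (print integrates `(d/dt)C′` along the segment `λ − H′(tX₁ + (1−t)X₂)`, `0 ≤ t ≤ 1`): if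
`μ₁`, `μ₂` satisfy `‖R(U₀(b))μᵢ(b₊) − μᵢ(b₋)‖ < a·s`, `‖μᵢ(x)‖ < a`, so does every point `μ₂ + t(μ₁ − μ₂)`, `t ∈ [0, 1]`, of the segment.
[cite: Balaban1985RegularSpaces, (1.122) p.96, (1.119)–(1.120) p.96] -/
theorem segment_mem_dom207 {U₀ : Site d → Fin d → 𝔸ˣ} {μ₁ μ₂ : Site d → 𝔸} {a s : ℝ}
    (h₁a : ∀ (x : Site d) (κ : Fin d), ‖cj (U₀ x κ) (μ₁ (x + e κ)) - μ₁ x‖ < a * s) (h₁b : ∀ x : Site d, ‖μ₁ x‖ < a)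
    (h₂a : ∀ (x : Site d) (κ : Fin d), ‖cj (U₀ x κ) (μ₂ (x + e κ)) - μ₂ x‖ < a * s) (h₂b : ∀ x : Site d, ‖μ₂ x‖ < a)
    {t : ℝ} (ht0 : 0 ≤ t) (ht1 : t ≤ 1) :
    (∀ (x : Site d) (κ : Fin d),
        ‖cj (U₀ x κ) ((μ₂ + (t : ℂ) • (μ₁ - μ₂)) (x + e κ)) - (μ₂ + (t : ℂ) • (μ₁ - μ₂)) x‖ < a * s) ∧
      ∀ x : Site d, ‖(μ₂ + (t : ℂ) • (μ₁ - μ₂)) x‖ < a := by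
  refine ⟨fun x κ => ?_, fun x => ?_⟩
  · rw [cjDiff_line, cjDiff_sub]
    exact norm_add_real_smul_sub_lt (h₁a x κ) (h₂a x κ) ht0 ht1
  · exact norm_add_real_smul_sub_lt (h₁b x) (h₂b x) ht0 ht1

end Segment

section Eq1122

variable {𝔸 : Type*} [NormedRing 𝔸] [NormOneClass 𝔸] [NormedAlgebra ℂ 𝔸] [CompleteSpace 𝔸]

omit [NormOneClass 𝔸] [CompleteSpace 𝔸] in
/-- A complex derivative at a real point is a real derivative of the restriction to the real axis (vector-valued form of Mathlib's
`HasDerivAt.comp_ofReal`). [folklore] -/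
private theorem hasDerivAt_comp_ofReal_vec {g : ℂ → 𝔸} {g' : 𝔸} {t : ℝ} (hg : HasDerivAt g g' (t : ℂ)) :
    HasDerivAt (fun s : ℝ => g (s : ℂ)) g' t := by
  have h := ((hg.hasFDerivAt.restrictScalars ℝ).comp t Complex.ofRealCLM.hasFDerivAt).hasDerivAt
  have h' : HasDerivAt (g ∘ Complex.ofReal) g' t := h.congr_deriv (by simp)
  exact h'

/-- **(1.122) FOR `C′_j(u₁, ·)`** (p. 96: «`C′(λ − H′X₁) − C′(λ − H′X₂) = ∫₀¹ dt (d/dt) C′(λ − H′(tX₁ + (1−t)X₂)) = −∫₀¹ dt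
⟨(δ/δλ)C′(λ − H′(tX₁ + (1−t)X₂)), H′(X₁ − X₂)⟩`»), written for the two end-points `μ₁ = λ − H′X₁`, `μ₂ = λ − H′X₂`: if `μ₁`, `μ₂` lie in
the (207)-domain = (1.120) (`‖R(U₀(b))μᵢ(b₊) − μᵢ(b₋)‖ < α₄η`, `‖μᵢ(x)‖ < α₄`, `η = L⁻ᵏ`), then for all `j ≤ k`, `z`:
`C′_j(u₁, μ₁)(z) − C′_j(u₁, μ₂)(z) = ∫₀¹ ⟨δC′_j(u₁, μ₂ + t(μ₁ − μ₂)), μ₁ − μ₂⟩(z) dt` — the fundamental theorem of calculus for the real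
restriction of the analytic curve `τ ↦ C′_j(u₁, μ₂ + τ(μ₁ − μ₂))(z)` (the segment stays in the domain, `segment_mem_dom207`; the integrand
is its derivative by (1.123) and a translation, and is continuous).  Data and smallness as in `B8Eq1123Concrete.analyticAt_Cnl_family`.
[cite: Balaban1985RegularSpaces, (1.122) p.96] -/
theorem eq1122 {L : ℕ} (hL : 2 ≤ L) {G : Subgroup 𝔸ˣ} (hG : AvgClosed d L G) {U₀ : Site d → Fin d → 𝔸ˣ}
    (hU : ∀ x κ, U₀ x κ ∈ G) {k : ℕ} (μ₁ μ₂ : Site d → 𝔸)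
    {u₁ : Site d → 𝔸ˣ} {α₀ α₃ α₄ : ℝ}
    (hα : 0 < α₀) (hα3 : C0 d * α₀ ≤ 1 / 3) (hα2 : 2 * α₀ ≤ c2' d L)
    (h52 : pdev U₀ < α₀ * (((L : ℝ) ^ k)⁻¹) ^ 2)
    (h₁a : ∀ (x : Site d) (κ : Fin d), ‖cj (U₀ x κ) (μ₁ (x + e κ)) - μ₁ x‖ < α₄ * ((L : ℝ) ^ k)⁻¹)
    (h₁b : ∀ x : Site d, ‖μ₁ x‖ < α₄)
    (h₂a : ∀ (x : Site d) (κ : Fin d), ‖cj (U₀ x κ) (μ₂ (x + e κ)) - μ₂ x‖ < α₄ * ((L : ℝ) ^ k)⁻¹)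
    (h₂b : ∀ x : Site d, ‖μ₂ x‖ < α₄)
    (hu₁ : InLambda L U₀ u₁ k α₃ (((L : ℝ) ^ k)⁻¹))
    (hα₃ : 0 ≤ α₃) (hα₃' : α₃ ≤ 1 / 50)
    (hs₁ : 40 * C6 d * α₄ ≤ 1) (hs₂ : 12000 * ((d : ℝ) + 1) * L * α₄ ≤ 1) (hs₃ : C4G d L * (α₀ + α₃ + 4 * α₄) ≤ 1)
    (hs₄ : 1024 * ((d : ℝ) + 1) * ((d : ℝ) + 4) * L ^ 2 * α₀ ≤ 1) (hs₅ : 32 * ((d : ℝ) + 1) ^ 2 * C6 d * L ^ 2 * α₀ ≤ 1)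
    (hs₆ : 16 * d * C5' d * C6 d * (L : ℝ) ^ 2 * α₀ ≤ 1) :
    ∀ j ≤ k, ∀ z : Site d,
      Cnl L U₀ u₁ j μ₁ z - Cnl L U₀ u₁ j μ₂ z =
        ∫ t in (0 : ℝ)..1, dCnl L U₀ u₁ j (μ₂ + (t : ℂ) • (μ₁ - μ₂)) (μ₁ - μ₂) z := by
  intro j hj z
  -- the complex curve through the segment
  set g : ℂ → 𝔸 := fun τ => Cnl L U₀ u₁ j (μ₂ + τ • (μ₁ - μ₂)) z with hgdef
  -- analyticity of `g` at the real points of `[0, 1]`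
  have hga : ∀ t : ℝ, t ∈ Set.Icc (0 : ℝ) 1 → AnalyticAt ℂ g (t : ℂ) := by
    intro t ht
    obtain ⟨ha, hb⟩ := segment_mem_dom207 h₁a h₁b h₂a h₂b ht.1 ht.2
    have hfam : ∀ x, AnalyticAt ℂ (fun σ : ℂ => (μ₂ + σ • (μ₁ - μ₂)) x) (t : ℂ) := fun x =>
      analyticAt_const.fun_add (analyticAt_id.fun_smul analyticAt_const)
    exact analyticAt_Cnl_family (Λ := fun σ : ℂ => μ₂ + σ • (μ₁ - μ₂)) (t₀ := (t : ℂ)) hL hG hU hfam hα hα3 hα2 h52 ha hb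
      hu₁ hα₃ hα₃' hs₁ hs₂ hs₃ hs₄ hs₅ hs₆ j hj z
  -- the integrand is the derivative of `g` along the segment ((1.123) translated to the point `μ₂ + t(μ₁ − μ₂)`)
  have hder : ∀ t : ℝ, dCnl L U₀ u₁ j (μ₂ + (t : ℂ) • (μ₁ - μ₂)) (μ₁ - μ₂) z = deriv g (t : ℂ) := by
    intro t
    rw [dCnl]
    have h : (fun σ : ℂ => Cnl L U₀ u₁ j (μ₂ + (t : ℂ) • (μ₁ - μ₂) + σ • (μ₁ - μ₂)) z) = fun σ : ℂ => g ((t : ℂ) + σ) := by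
      funext σ; simp only [hgdef, add_smul, add_assoc]
    rw [h, deriv_comp_const_add, add_zero]
  have hreal : ∀ t ∈ Set.uIcc (0 : ℝ) 1, HasDerivAt (fun s : ℝ => g (s : ℂ)) (deriv g (t : ℂ)) t := by
    intro t ht
    rw [Set.uIcc_of_le zero_le_one] at ht
    exact hasDerivAt_comp_ofReal_vec (hga t ht).differentiableAt.hasDerivAt
  have hcont : ContinuousOn (fun t : ℝ => deriv g (t : ℂ)) (Set.uIcc (0 : ℝ) 1) := by
    intro t ht
    rw [Set.uIcc_of_le zero_le_one] at ht
    exact (((hga t ht).deriv.continuousAt).comp Complex.continuous_ofReal.continuousAt).continuousWithinAt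
  have hftc := intervalIntegral.integral_eq_sub_of_hasDerivAt hreal hcont.intervalIntegrable
  have hg1 : g ((1 : ℝ) : ℂ) = Cnl L U₀ u₁ j μ₁ z := by simp [hgdef]
  have hg0 : g ((0 : ℝ) : ℂ) = Cnl L U₀ u₁ j μ₂ z := by simp [hgdef]
  simp_rw [hder]
  rw [hftc, hg1, hg0]

/-- **(1.122) IN PRINT'S LETTERS, with the sign**: for ANY `ℂ`-linear map `H′` (in print the operator of (1.92); its lattice construction
is not needed for this identity) and `λ, X₁, X₂` with `λ − H′X₁`, `λ − H′X₂` in the (207)-domain = (1.120):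
`C′(λ − H′X₁) − C′(λ − H′X₂) = −∫₀¹ ⟨δC′(λ − H′(tX₁ + (1−t)X₂)), H′(X₁ − X₂)⟩ dt` (`C′ = C′_j(u₁, ·)` at the site `z`, `j ≤ k`) —
`eq1122`, the linearity of `H′` and `⟨δC′(μ), −λ₀⟩ = −⟨δC′(μ), λ₀⟩` (`B8Eq1123Concrete.dCnl_neg`).
[cite: Balaban1985RegularSpaces, (1.122) p.96] -/
theorem eq1122_printed {L : ℕ} (hL : 2 ≤ L) {G : Subgroup 𝔸ˣ} (hG : AvgClosed d L G) {U₀ : Site d → Fin d → 𝔸ˣ}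
    (hU : ∀ x κ, U₀ x κ ∈ G) {k : ℕ} {F : Type*} [AddCommGroup F] [Module ℂ F] (H' : F →ₗ[ℂ] (Site d → 𝔸))
    (lam : Site d → 𝔸) (X₁ X₂ : F)
    {u₁ : Site d → 𝔸ˣ} {α₀ α₃ α₄ : ℝ}
    (hα : 0 < α₀) (hα3 : C0 d * α₀ ≤ 1 / 3) (hα2 : 2 * α₀ ≤ c2' d L)
    (h52 : pdev U₀ < α₀ * (((L : ℝ) ^ k)⁻¹) ^ 2)
    (h₁a : ∀ (x : Site d) (κ : Fin d), ‖cj (U₀ x κ) ((lam - H' X₁) (x + e κ)) - (lam - H' X₁) x‖ < α₄ * ((L : ℝ) ^ k)⁻¹)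
    (h₁b : ∀ x : Site d, ‖(lam - H' X₁) x‖ < α₄)
    (h₂a : ∀ (x : Site d) (κ : Fin d), ‖cj (U₀ x κ) ((lam - H' X₂) (x + e κ)) - (lam - H' X₂) x‖ < α₄ * ((L : ℝ) ^ k)⁻¹)
    (h₂b : ∀ x : Site d, ‖(lam - H' X₂) x‖ < α₄)
    (hu₁ : InLambda L U₀ u₁ k α₃ (((L : ℝ) ^ k)⁻¹))
    (hα₃ : 0 ≤ α₃) (hα₃' : α₃ ≤ 1 / 50)
    (hs₁ : 40 * C6 d * α₄ ≤ 1) (hs₂ : 12000 * ((d : ℝ) + 1) * L * α₄ ≤ 1) (hs₃ : C4G d L * (α₀ + α₃ + 4 * α₄) ≤ 1)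
    (hs₄ : 1024 * ((d : ℝ) + 1) * ((d : ℝ) + 4) * L ^ 2 * α₀ ≤ 1) (hs₅ : 32 * ((d : ℝ) + 1) ^ 2 * C6 d * L ^ 2 * α₀ ≤ 1)
    (hs₆ : 16 * d * C5' d * C6 d * (L : ℝ) ^ 2 * α₀ ≤ 1) :
    ∀ j ≤ k, ∀ z : Site d,
      Cnl L U₀ u₁ j (lam - H' X₁) z - Cnl L U₀ u₁ j (lam - H' X₂) z =
        -∫ t in (0 : ℝ)..1, dCnl L U₀ u₁ j (lam - H' ((t : ℂ) • X₁ + (1 - (t : ℂ)) • X₂)) (H' (X₁ - X₂)) z := by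
  intro j hj z
  rw [eq1122 hL hG hU (lam - H' X₁) (lam - H' X₂) hα hα3 hα2 h52 h₁a h₁b h₂a h₂b hu₁ hα₃ hα₃' hs₁ hs₂ hs₃ hs₄ hs₅ hs₆ j hj z,
    ← intervalIntegral.integral_neg]
  refine intervalIntegral.integral_congr fun t _ => ?_
  have hdir : lam - H' X₁ - (lam - H' X₂) = -(H' (X₁ - X₂)) := by rw [map_sub]; abel
  have hpt : lam - H' X₂ + (t : ℂ) • (lam - H' X₁ - (lam - H' X₂)) = lam - H' ((t : ℂ) • X₁ + (1 - (t : ℂ)) • X₂) := by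
    simp only [map_add, map_sub, map_smul, smul_sub, sub_smul, one_smul]; abel
  show dCnl L U₀ u₁ j (lam - H' X₂ + (t : ℂ) • (lam - H' X₁ - (lam - H' X₂))) (lam - H' X₁ - (lam - H' X₂)) z = _
  rw [hpt, hdir, dCnl_neg]

/-- **«Applying it to the expression (1.122) we have `|C′(λ − H′X₁) − C′(λ − H′X₂)| ≦ C′₂ 2B′₀(α₃ + α₄)|X₁ − X₂|`»** (p. 97), in the
form the contraction argument uses: for `μ₁`, `μ₂` in the half-size set (1.119) (`‖R(U₀(b))μᵢ(b₊) − μᵢ(b₋)‖ < ½α₄η`, `‖μᵢ(x)‖ < ½α₄`,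
`η = L⁻ᵏ`) whose difference has modulus `max{|μ₁ − μ₂|, |D(μ₁ − μ₂)|} ≤ m`, for all `j ≤ k`, `z`:
`‖C′_j(u₁, μ₁)(z) − C′_j(u₁, μ₂)(z)‖ ≤ C′₂·2m·(α₃ + α₄)·LʲL⁻ᵏ` (`≤ C′₂·2m·(α₃ + α₄)`).  Print's instance: `μᵢ = λ − H′Xᵢ`,
`m = B′₀|X₁ − X₂|` by (1.120)/(1.92); these `μᵢ` lie in the FULL-size set (1.120), i.e. print uses the instance `α₄ ↦ 2α₄` of this
theorem (module READING (f), HOME/GAPS.md G-B8-17: constants only).  Proof = print's: (1.122) (`eq1122`), the segment stays in (1.119)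
(`segment_mem_dom207`), (1.125) at every point of it (`ineq1125`), `‖∫₀¹‖ ≤ sup`. [cite: Balaban1985RegularSpaces, (1.122)–(1.125) pp.96–97] -/
theorem lipschitz1122 {L : ℕ} (hL : 2 ≤ L) {G : Subgroup 𝔸ˣ} (hG : AvgClosed d L G) {U₀ : Site d → Fin d → 𝔸ˣ}
    (hU : ∀ x κ, U₀ x κ ∈ G) {k : ℕ} (μ₁ μ₂ : Site d → 𝔸) {m : ℝ}
    {u₁ : Site d → 𝔸ˣ} {α₀ α₃ α₄ : ℝ}
    (hα : 0 < α₀) (hα3 : C0 d * α₀ ≤ 1 / 3) (hα2 : 2 * α₀ ≤ c2' d L)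
    (h52 : pdev U₀ < α₀ * (((L : ℝ) ^ k)⁻¹) ^ 2)
    (h₁a : ∀ (x : Site d) (κ : Fin d), ‖cj (U₀ x κ) (μ₁ (x + e κ)) - μ₁ x‖ < α₄ / 2 * ((L : ℝ) ^ k)⁻¹)
    (h₁b : ∀ x : Site d, ‖μ₁ x‖ < α₄ / 2)
    (h₂a : ∀ (x : Site d) (κ : Fin d), ‖cj (U₀ x κ) (μ₂ (x + e κ)) - μ₂ x‖ < α₄ / 2 * ((L : ℝ) ^ k)⁻¹)
    (h₂b : ∀ x : Site d, ‖μ₂ x‖ < α₄ / 2)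
    (hma : ∀ (x : Site d) (κ : Fin d), ‖cj (U₀ x κ) ((μ₁ - μ₂) (x + e κ)) - (μ₁ - μ₂) x‖ ≤ m * ((L : ℝ) ^ k)⁻¹)
    (hmb : ∀ x : Site d, ‖(μ₁ - μ₂) x‖ ≤ m)
    (hu₁ : InLambda L U₀ u₁ k α₃ (((L : ℝ) ^ k)⁻¹))
    (hα₃ : 0 ≤ α₃) (hα₃' : α₃ ≤ 1 / 200)
    (hs₁ : 200 * C6 d * α₄ ≤ 1) (hs₂ : 12000 * ((d : ℝ) + 1) * L * α₄ ≤ 1) (hs₃ : C4G d L * (α₀ + α₃ + 4 * α₄) ≤ 1)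
    (hs₄ : 1024 * ((d : ℝ) + 1) * ((d : ℝ) + 4) * L ^ 2 * α₀ ≤ 1) (hs₅ : 32 * ((d : ℝ) + 1) ^ 2 * C6 d * L ^ 2 * α₀ ≤ 1)
    (hs₆ : 16 * d * C5' d * C6 d * (L : ℝ) ^ 2 * α₀ ≤ 1) (hs₇ : 8 * d * C6 d * L * α₀ ≤ 1) :
    ∀ j ≤ k, ∀ z : Site d,
      ‖Cnl L U₀ u₁ j μ₁ z - Cnl L U₀ u₁ j μ₂ z‖ ≤ C2p d * (2 * m) * (α₃ + α₄) * ((L : ℝ) ^ j * ((L : ℝ) ^ k)⁻¹) := by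
  intro j hj z
  have hm0 : 0 ≤ m := (norm_nonneg _).trans (hmb 0)
  rcases hm0.eq_or_lt with hm | hm
  · -- `m = 0` forces `μ₁ = μ₂`
    have hμ : μ₁ = μ₂ := by
      funext x
      have hx := hmb x
      rw [← hm, Pi.sub_apply] at hx
      exact sub_eq_zero.mp (norm_le_zero_iff.mp hx)
    subst hμ
    rw [sub_self, norm_zero, ← hm]
    simp
  · have hα₄ : 0 < α₄ := by linarith [norm_nonneg (μ₁ 0), h₁b 0]
    have hC6 : (2 : ℝ) ≤ C6 d := by unfold C6; linarith [one_le_C5 (d := d)]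
    have hs₁' : 40 * C6 d * α₄ ≤ 1 := by nlinarith
    have hα₃'' : α₃ ≤ 1 / 50 := hα₃'.trans (by norm_num)
    have hs : (0 : ℝ) ≤ ((L : ℝ) ^ k)⁻¹ := by positivity
    have hhalf : α₄ / 2 * ((L : ℝ) ^ k)⁻¹ ≤ α₄ * ((L : ℝ) ^ k)⁻¹ :=
      mul_le_mul_of_nonneg_right (by linarith) hs
    have h₁a' : ∀ (x : Site d) (κ : Fin d), ‖cj (U₀ x κ) (μ₁ (x + e κ)) - μ₁ x‖ < α₄ * ((L : ℝ) ^ k)⁻¹ :=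
      fun x κ => (h₁a x κ).trans_le hhalf
    have h₂a' : ∀ (x : Site d) (κ : Fin d), ‖cj (U₀ x κ) (μ₂ (x + e κ)) - μ₂ x‖ < α₄ * ((L : ℝ) ^ k)⁻¹ :=
      fun x κ => (h₂a x κ).trans_le hhalf
    have h₁b' : ∀ x : Site d, ‖μ₁ x‖ < α₄ := fun x => (h₁b x).trans (by linarith)
    have h₂b' : ∀ x : Site d, ‖μ₂ x‖ < α₄ := fun x => (h₂b x).trans (by linarith)
    rw [eq1122 hL hG hU μ₁ μ₂ hα hα3 hα2 h52 h₁a' h₁b' h₂a' h₂b' hu₁ hα₃ hα₃'' hs₁' hs₂ hs₃ hs₄ hs₅ hs₆ j hj z]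
    have hbound : ∀ t ∈ Set.uIoc (0 : ℝ) 1,
        ‖dCnl L U₀ u₁ j (μ₂ + (t : ℂ) • (μ₁ - μ₂)) (μ₁ - μ₂) z‖ ≤
          C2p d * (2 * m) * (α₃ + α₄) * ((L : ℝ) ^ j * ((L : ℝ) ^ k)⁻¹) := by
      intro t ht
      rw [Set.uIoc_of_le zero_le_one] at ht
      obtain ⟨ha, hb⟩ := segment_mem_dom207 h₁a h₁b h₂a h₂b ht.1.le ht.2
      exact ineq1125 hL hG hU hα hα3 hα2 h52 ha hb hma hmb hm hu₁ hα₃ hα₃' hs₁ hs₂ hs₃ hs₄ hs₅ hs₆ hs₇ j hj z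
    have h := intervalIntegral.norm_integral_le_of_norm_le_const hbound
    rwa [sub_zero, abs_one, mul_one] at h

end Eq1122

end Literature.MathematicalPhysics.QuantumFieldTheory.Balaban1983to89.B8Eq1122Concrete

end
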